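import Summits.SmoothPoincare4.SmoothPoincare4.Theorems.CongruenceShadowsNilpotentShadowsStandardGlueNilpotentBasis
import Literature.GroupTheory.CombinatorialGroupTheory.LowerCentralSeriesLieRing
import HarnessLib

/-!
# Helper II (Johnson calculus at level `k`) for stub `stub_layerStepZeroOne` of line `nilpotent-genus-class`,
crux `CongruenceShadows.ShadowApproximation` (item stmt-SmoothPoincare4-14595)

General group theory, `γₙ₊₁ = (⊤ : Subgroup G).lowerCentralSeries n`.  The `k`-th term of the
Johnson–Andreadakis filtration is `𝒥ₖ = {ψ ∈ Aut G | ψ(s)s⁻¹ ∈ γₖ₊₁ ∀ s}` (`𝒥₁ = IA`).  This file is the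
level-`k` version of the landed IA-calculus `…NilpotentShadowsStandardJohnsonClassTwo` (which is `k = 1`):
* `jk_lcs`: an endomorphism congruent to the identity modulo `γₖ₊₁` is congruent to the identity modulo
  `γₖ₊ₘ₊₁` on `γₘ₊₁` (induction on `m` over commutator generators);
* the Johnson map `s ↦ ψ(s)s⁻¹ (mod γₖ₊₂)` on `𝒥ₖ` is a homomorphism (`jk_quot_mul`, `_inv`, `_zpow`),
  constant on `γ₂`-cosets (`jk_quot_congr`), and additive under composition, inversion, powers and list
  products in `Aut G` (`jk_quot_trans`, `jk_quot_symm`, `jk_zpow`, `jk_list_prod_zpow`), and evaluates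
  products of powers of letters termwise (`jk_quot_list_prod_zpow`).
Used at `k = 2` (data of products of separating twists) and `k = 1` (IA acts trivially on `γ₃/γ₄`).
Registered sub-goal: `helper_johnsonLayerAction`.  Mathlib + the tree only; no definitions.
-/

set_option linter.dupNamespace false

open Subgroup
open scoped commutatorElement
open Summit.SmoothPoincare4.SmoothPoincare4.Theorems.NilpotentShadowsStandard.SaturatedTorsorDescent
  (mk_lcs_mem_center mul_inv_mem_iff_quot quot_commutatorElement equiv_mem_lcs commutatorElement_central_mul_eq
    lcs_antitone)
open Literature.GroupTheory.CombinatorialGroupTheory (commutator_mem_lcs_of_eq commutator_mem_lcs commutator_mem_lcs_succ)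

namespace Summit.SmoothPoincare4.SmoothPoincare4.Theorems.ShadowApproximation.NilpotentGenusClass

namespace LayerZeroOne

variable {G : Type*} [Group G] {k : ℕ}

/-! ## The `k`-th Johnson subgroup `𝒥ₖ = {ψ | ψ(s)s⁻¹ ∈ γₖ₊₁}` acts trivially on every layer -/

/-- A central left factor does not change a commutator: `⁅c x, y⁆ = ⁅x, y⁆`. [folklore] -/
theorem commutatorElement_central_mul_left {M : Type*} [Group M] {c : M} (hc : c ∈ center M) (x y : M) :
    ⁅c * x, y⁆ = ⁅x, y⁆ := by
  simpa using commutatorElement_central_mul_eq hc (Subgroup.one_mem _) x y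

/-- Conjugating by `c` does not change an element commuting with `c` modulo `N`. [folklore] -/
theorem commutatorElement_mul_right_eq {M : Type*} [Group M] (a b c : M) :
    ⁅a, b * c⁆ = ⁅a, b⁆ * (b * ⁅a, c⁆ * b⁻¹) := by
  simp only [commutatorElement_def]; group

/-- **`𝒥ₖ` acts trivially on `γₘ₊₁ / γₖ₊ₘ₊₁`**: if `κ x · x⁻¹ ∈ γₖ₊₁` for all `x`, then
`κ y · y⁻¹ ∈ γₖ₊ₘ₊₁` for `y ∈ γₘ₊₁` (Mathlib numbering `γₙ₊₁ = lowerCentralSeries n`; no hypothesis on `k`). [folklore] -/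
theorem jk_lcs (κ : G →* G) (hκ : ∀ x, κ x * x⁻¹ ∈ (⊤ : Subgroup G).lowerCentralSeries k)
    (m : ℕ) : ∀ y ∈ (⊤ : Subgroup G).lowerCentralSeries m, κ y * y⁻¹ ∈ (⊤ : Subgroup G).lowerCentralSeries (k + m) := by
  induction m with
  | zero => intro y _; simpa using hκ y
  | succ m ih =>
    intro y hy
    have hy' : y ∈ closure {g : G | ∃ p ∈ (⊤ : Subgroup G).lowerCentralSeries m,
        ∃ q ∈ (⊤ : Subgroup G), ⁅p, q⁆ = g} := hy
    clear hy
    induction hy' using Subgroup.closure_induction with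
    | mem g hg =>
      obtain ⟨p, hp, q, -, rfl⟩ := hg
      rw [mul_inv_mem_iff_quot, map_commutatorElement, quot_commutatorElement, quot_commutatorElement]
      have ep : ((κ p : G) : G ⧸ (⊤ : Subgroup G).lowerCentralSeries (k + (m + 1))) =
          ((κ p * p⁻¹ : G) : G ⧸ (⊤ : Subgroup G).lowerCentralSeries (k + (m + 1))) * (p : G ⧸ _) := by
        rw [← QuotientGroup.mk_mul, inv_mul_cancel_right]
      have eq' : ((κ q : G) : G ⧸ (⊤ : Subgroup G).lowerCentralSeries (k + (m + 1))) =
          ((κ q * q⁻¹ : G) : G ⧸ (⊤ : Subgroup G).lowerCentralSeries (k + (m + 1))) * (q : G ⧸ _) := by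
        rw [← QuotientGroup.mk_mul, inv_mul_cancel_right]
      have hcen : ((κ p * p⁻¹ : G) : G ⧸ (⊤ : Subgroup G).lowerCentralSeries (k + (m + 1))) ∈
          center (G ⧸ (⊤ : Subgroup G).lowerCentralSeries (k + (m + 1))) := mk_lcs_mem_center (ih p hp)
      rw [ep, eq', commutatorElement_central_mul_left hcen, commutatorElement_mul_right_eq]
      have h1 : ⁅(p : G ⧸ (⊤ : Subgroup G).lowerCentralSeries (k + (m + 1))),
          ((κ q * q⁻¹ : G) : G ⧸ (⊤ : Subgroup G).lowerCentralSeries (k + (m + 1)))⁆ = 1 := by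
        rw [← quot_commutatorElement, QuotientGroup.eq_one_iff]
        exact commutator_mem_lcs_of_eq (by omega) hp (hκ q)
      have h2 : ((κ q * q⁻¹ : G) : G ⧸ (⊤ : Subgroup G).lowerCentralSeries (k + (m + 1))) *
          ((⁅p, q⁆ : G) : G ⧸ (⊤ : Subgroup G).lowerCentralSeries (k + (m + 1))) *
            ((κ q * q⁻¹ : G) : G ⧸ (⊤ : Subgroup G).lowerCentralSeries (k + (m + 1)))⁻¹ =
          ((⁅p, q⁆ : G) : G ⧸ (⊤ : Subgroup G).lowerCentralSeries (k + (m + 1))) := by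
        rw [← mul_inv_eq_one, ← commutatorElement_def, ← quot_commutatorElement, QuotientGroup.eq_one_iff]
        refine lcs_antitone (show k + (m + 1) ≤ k + (m + 1) + 1 by omega) ?_
        exact commutator_mem_lcs_of_eq (show k + (m + 1) + 1 = k + (m + 1) + 1 from rfl) (hκ q)
          (commutator_mem_lcs_succ hp q)
      rw [h1, one_mul, ← quot_commutatorElement, h2]
    | one => rw [map_one, mul_inv_cancel]; exact one_mem _
    | mul a b _ _ iha ihb =>
      have e : κ (a * b) * (a * b)⁻¹ = (κ a * a⁻¹) * (a * (κ b * b⁻¹) * a⁻¹) := by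
        rw [map_mul]; group
      rw [e]
      exact mul_mem iha (Subgroup.Normal.conj_mem inferInstance _ ihb a)
    | inv a _ ih =>
      have e : κ a⁻¹ * a⁻¹⁻¹ = a⁻¹ * (κ a * a⁻¹)⁻¹ * a⁻¹⁻¹ := by rw [map_inv]; group
      rw [e]
      exact Subgroup.Normal.conj_mem inferInstance _ (inv_mem ih) a⁻¹

/-! ## The Johnson map `x ↦ ψ(x) x⁻¹ (mod γₖ₊₂)` on `𝒥ₖ` -/

/-- Elements of `γₖ₊₁` are central modulo `γₖ₊₂`. [folklore] -/
theorem jk_central {p : G} (hp : p ∈ (⊤ : Subgroup G).lowerCentralSeries k)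
    (q : G ⧸ (⊤ : Subgroup G).lowerCentralSeries (k + 1)) :
    (p : G ⧸ (⊤ : Subgroup G).lowerCentralSeries (k + 1)) * q = q * p :=
  ((mem_center_iff.1 (mk_lcs_mem_center hp)) q).symm

/-- `𝒥ₖ` is closed under inverses. [folklore] -/
theorem jk_symm {ψ : G ≃* G} (hψ : ∀ s, ψ s * s⁻¹ ∈ (⊤ : Subgroup G).lowerCentralSeries k) (s : G) :
    ψ.symm s * s⁻¹ ∈ (⊤ : Subgroup G).lowerCentralSeries k := by
  have h1 := inv_mem (hψ (ψ.symm s))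
  rw [MulEquiv.apply_symm_apply] at h1
  simpa using h1

/-- `𝒥ₖ` is closed under composition. [folklore] -/
theorem jk_trans {ψ φ : G ≃* G} (hψ : ∀ s, ψ s * s⁻¹ ∈ (⊤ : Subgroup G).lowerCentralSeries k)
    (hφ : ∀ s, φ s * s⁻¹ ∈ (⊤ : Subgroup G).lowerCentralSeries k) (s : G) :
    (ψ.trans φ) s * s⁻¹ ∈ (⊤ : Subgroup G).lowerCentralSeries k := by
  have e : φ (ψ s) * s⁻¹ = (φ (ψ s) * (ψ s)⁻¹) * (ψ s * s⁻¹) := by group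
  rw [MulEquiv.trans_apply, e]
  exact mul_mem (hφ _) (hψ _)

/-- **The `k`-th Johnson map is a homomorphism modulo `γₖ₊₂`**: `ψ(xy)(xy)⁻¹ ≡ (ψx x⁻¹)(ψy y⁻¹)`.
[folklore] -/
theorem jk_quot_mul {ψ : G ≃* G} (hψ : ∀ s, ψ s * s⁻¹ ∈ (⊤ : Subgroup G).lowerCentralSeries k) (x y : G) :
    ((ψ (x * y) * (x * y)⁻¹ : G) : G ⧸ (⊤ : Subgroup G).lowerCentralSeries (k + 1)) =
      ((ψ x * x⁻¹ : G) : G ⧸ (⊤ : Subgroup G).lowerCentralSeries (k + 1)) * (ψ y * y⁻¹ : G) := by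
  have e : ψ (x * y) * (x * y)⁻¹ = (ψ x * x⁻¹) * (x * (ψ y * y⁻¹) * x⁻¹) := by
    simp only [map_mul]; group
  rw [e, QuotientGroup.mk_mul _ (ψ x * x⁻¹), QuotientGroup.mk_mul _ (x * _), QuotientGroup.mk_mul _ x,
    ← jk_central (hψ y), QuotientGroup.mk_inv, mul_inv_cancel_right]

/-- The Johnson map kills `1`. [folklore] -/
theorem jk_quot_one (ψ : G ≃* G) :
    ((ψ 1 * 1⁻¹ : G) : G ⧸ (⊤ : Subgroup G).lowerCentralSeries (k + 1)) = 1 := by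
  rw [map_one, inv_one, mul_one, QuotientGroup.mk_one]

/-- The Johnson map on an inverse. [folklore] -/
theorem jk_quot_inv {ψ : G ≃* G} (hψ : ∀ s, ψ s * s⁻¹ ∈ (⊤ : Subgroup G).lowerCentralSeries k) (x : G) :
    ((ψ x⁻¹ * x⁻¹⁻¹ : G) : G ⧸ (⊤ : Subgroup G).lowerCentralSeries (k + 1)) =
      ((ψ x * x⁻¹ : G) : G ⧸ (⊤ : Subgroup G).lowerCentralSeries (k + 1))⁻¹ := by
  have h := jk_quot_mul hψ x x⁻¹
  rw [mul_inv_cancel, jk_quot_one] at h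
  exact eq_inv_of_mul_eq_one_right h.symm

/-- The Johnson map on a power. [folklore] -/
theorem jk_quot_zpow {ψ : G ≃* G} (hψ : ∀ s, ψ s * s⁻¹ ∈ (⊤ : Subgroup G).lowerCentralSeries k)
    (x : G) (n : ℤ) :
    ((ψ (x ^ n) * (x ^ n)⁻¹ : G) : G ⧸ (⊤ : Subgroup G).lowerCentralSeries (k + 1)) =
      ((ψ x * x⁻¹ : G) : G ⧸ (⊤ : Subgroup G).lowerCentralSeries (k + 1)) ^ n := by
  induction n using Int.induction_on with
  | zero => rw [zpow_zero, zpow_zero]; exact jk_quot_one ψ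
  | succ n ih => rw [zpow_add_one, jk_quot_mul hψ, ih, zpow_add_one]
  | pred n ih => rw [zpow_sub_one, jk_quot_mul hψ, ih, jk_quot_inv hψ, zpow_sub_one]

/-- **`𝒥ₖ` acts trivially on `γ₂/γₖ₊₂`**. [folklore] -/
theorem jk_quot_lcs {ψ : G ≃* G} (hψ : ∀ s, ψ s * s⁻¹ ∈ (⊤ : Subgroup G).lowerCentralSeries k)
    {l : G} (hl : l ∈ (⊤ : Subgroup G).lowerCentralSeries 1) :
    ((ψ l * l⁻¹ : G) : G ⧸ (⊤ : Subgroup G).lowerCentralSeries (k + 1)) = 1 := by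
  rw [QuotientGroup.eq_one_iff]
  exact jk_lcs ψ.toMonoidHom hψ 1 l hl

/-- The Johnson map only depends on the class modulo `γ₂`. [folklore] -/
theorem jk_quot_congr {ψ : G ≃* G} (hψ : ∀ s, ψ s * s⁻¹ ∈ (⊤ : Subgroup G).lowerCentralSeries k)
    {x y : G} (h : x * y⁻¹ ∈ (⊤ : Subgroup G).lowerCentralSeries 1) :
    ((ψ x * x⁻¹ : G) : G ⧸ (⊤ : Subgroup G).lowerCentralSeries (k + 1)) = (ψ y * y⁻¹ : G) := by
  have e : x = (x * y⁻¹) * y := by rw [inv_mul_cancel_right]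
  conv_lhs => rw [e]
  rw [jk_quot_mul hψ, jk_quot_lcs hψ h, one_mul]

/-- The Johnson map of the inverse automorphism. [folklore] -/
theorem jk_quot_symm {ψ : G ≃* G} (hk : 1 ≤ k) (hψ : ∀ s, ψ s * s⁻¹ ∈ (⊤ : Subgroup G).lowerCentralSeries k)
    (x : G) :
    ((ψ.symm x * x⁻¹ : G) : G ⧸ (⊤ : Subgroup G).lowerCentralSeries (k + 1)) =
      ((ψ x * x⁻¹ : G) : G ⧸ (⊤ : Subgroup G).lowerCentralSeries (k + 1))⁻¹ := by
  have e1 : ψ.symm x * x⁻¹ = (ψ (ψ.symm x) * (ψ.symm x)⁻¹)⁻¹ := by simp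
  have hy : ψ.symm x = (ψ.symm x * x⁻¹) * x := by simp
  rw [e1, QuotientGroup.mk_inv]
  congr 1
  conv_lhs => rw [hy]
  have hl : ψ.symm x * x⁻¹ ∈ (⊤ : Subgroup G).lowerCentralSeries 1 :=
    lcs_antitone hk (jk_symm hψ x)
  rw [jk_quot_mul hψ, jk_quot_lcs hψ hl, one_mul]

/-- The Johnson map of a composite: `φ(ψ x) x⁻¹ ≡ (φx x⁻¹)(ψx x⁻¹)`. [folklore] -/
theorem jk_quot_trans {ψ φ : G ≃* G} (hk : 1 ≤ k) (hψ : ∀ s, ψ s * s⁻¹ ∈ (⊤ : Subgroup G).lowerCentralSeries k)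
    (hφ : ∀ s, φ s * s⁻¹ ∈ (⊤ : Subgroup G).lowerCentralSeries k) (x : G) :
    ((φ (ψ x) * x⁻¹ : G) : G ⧸ (⊤ : Subgroup G).lowerCentralSeries (k + 1)) =
      ((φ x * x⁻¹ : G) : G ⧸ (⊤ : Subgroup G).lowerCentralSeries (k + 1)) * (ψ x * x⁻¹ : G) := by
  have e : φ (ψ x) * x⁻¹ = (φ (ψ x * x⁻¹) * (ψ x * x⁻¹)⁻¹) * ((ψ x * x⁻¹) * (φ x * x⁻¹) * (ψ x * x⁻¹)⁻¹)
      * (ψ x * x⁻¹) := by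
    simp only [map_mul, map_inv]; group
  have hl : ψ x * x⁻¹ ∈ (⊤ : Subgroup G).lowerCentralSeries 1 := lcs_antitone hk (hψ x)
  rw [e, QuotientGroup.mk_mul, QuotientGroup.mk_mul, jk_quot_lcs hφ hl, one_mul,
    QuotientGroup.mk_mul, QuotientGroup.mk_mul, jk_central (hψ x), QuotientGroup.mk_inv,
    inv_mul_cancel_right, ← jk_central (hψ x)]

/-- Powers in `MulAut G` of an element of `𝒥ₖ` lie in `𝒥ₖ`, with Johnson value the power. [folklore] -/
theorem jk_zpow {ψ : G ≃* G} (hk : 1 ≤ k) (hψ : ∀ s, ψ s * s⁻¹ ∈ (⊤ : Subgroup G).lowerCentralSeries k) (n : ℤ) :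
    (∀ s, ((ψ : MulAut G) ^ n : MulAut G) s * s⁻¹ ∈ (⊤ : Subgroup G).lowerCentralSeries k) ∧
    ∀ x, ((((ψ : MulAut G) ^ n : MulAut G) x * x⁻¹ : G) : G ⧸ (⊤ : Subgroup G).lowerCentralSeries (k + 1)) =
      ((ψ x * x⁻¹ : G) : G ⧸ (⊤ : Subgroup G).lowerCentralSeries (k + 1)) ^ n := by
  induction n using Int.induction_on with
  | zero =>
    refine ⟨fun s => ?_, fun x => ?_⟩
    · rw [zpow_zero, MulAut.one_apply, mul_inv_cancel]; exact one_mem _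
    · rw [zpow_zero, zpow_zero, MulAut.one_apply, mul_inv_cancel, QuotientGroup.mk_one]
  | succ n ih =>
    obtain ⟨ih1, ih2⟩ := ih
    have e : ∀ s, ((ψ : MulAut G) ^ ((n : ℤ) + 1) : MulAut G) s = ((ψ : MulAut G) ^ (n : ℤ) : MulAut G) (ψ s) :=
      fun s => by rw [zpow_add_one, MulAut.mul_apply]
    refine ⟨fun s => ?_, fun x => ?_⟩
    · rw [e]; exact jk_trans hψ ih1 s
    · rw [e, jk_quot_trans hk hψ ih1, ih2, zpow_add_one]
  | pred n ih =>
    obtain ⟨ih1, ih2⟩ := ih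
    have e : ∀ s, ((ψ : MulAut G) ^ (-(n : ℤ) - 1) : MulAut G) s =
        ((ψ : MulAut G) ^ (-(n : ℤ)) : MulAut G) (ψ.symm s) :=
      fun s => by rw [zpow_sub_one, MulAut.mul_apply, MulAut.inv_def]
    refine ⟨fun s => ?_, fun x => ?_⟩
    · rw [e]; exact jk_trans (jk_symm hψ) ih1 s
    · rw [e, jk_quot_trans hk (jk_symm hψ) ih1, ih2, jk_quot_symm hk hψ, zpow_sub_one]

/-- A list product in `MulAut G` of elements of `𝒥ₖ` lies in `𝒥ₖ`, with Johnson value the product. [folklore] -/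
theorem jk_list_prod {ι : Type*} (hk : 1 ≤ k) (l : List ι) (Φ : ι → MulAut G)
    (hΦ : ∀ i, ∀ s, Φ i s * s⁻¹ ∈ (⊤ : Subgroup G).lowerCentralSeries k) :
    (∀ s, (l.map Φ).prod s * s⁻¹ ∈ (⊤ : Subgroup G).lowerCentralSeries k) ∧
    ∀ x, (((l.map Φ).prod x * x⁻¹ : G) : G ⧸ (⊤ : Subgroup G).lowerCentralSeries (k + 1)) =
      (l.map fun i => ((Φ i x * x⁻¹ : G) : G ⧸ (⊤ : Subgroup G).lowerCentralSeries (k + 1))).prod := by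
  induction l with
  | nil =>
    refine ⟨fun s => ?_, fun x => ?_⟩
    · rw [List.map_nil, List.prod_nil, MulAut.one_apply, mul_inv_cancel]; exact one_mem _
    · rw [List.map_nil, List.map_nil, List.prod_nil, List.prod_nil, MulAut.one_apply, mul_inv_cancel,
        QuotientGroup.mk_one]
  | cons i l ih =>
    obtain ⟨ih1, ih2⟩ := ih
    simp only [List.map_cons, List.prod_cons]
    refine ⟨fun s => ?_, fun x => ?_⟩
    · rw [MulAut.mul_apply]; exact jk_trans ih1 (hΦ i) s
    · rw [MulAut.mul_apply, jk_quot_trans hk ih1 (hΦ i), ih2]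

/-- **Johnson values of `∏ ψᵢ ^ nᵢ`** (`ψᵢ ∈ 𝒥ₖ`): the product is in `𝒥ₖ` and its value at `x` is
`∏ (ψᵢ x · x⁻¹) ^ nᵢ` modulo `γₖ₊₂`. [folklore] -/
theorem jk_list_prod_zpow {ι : Type*} (hk : 1 ≤ k) (l : List ι) (Ψ : ι → G ≃* G) (n : ι → ℤ)
    (hΨ : ∀ i, ∀ s, Ψ i s * s⁻¹ ∈ (⊤ : Subgroup G).lowerCentralSeries k) :
    (∀ s, (l.map fun i => ((Ψ i : MulAut G) ^ n i : MulAut G)).prod s * s⁻¹ ∈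
      (⊤ : Subgroup G).lowerCentralSeries k) ∧
    ∀ x, (((l.map fun i => ((Ψ i : MulAut G) ^ n i : MulAut G)).prod x * x⁻¹ : G) :
        G ⧸ (⊤ : Subgroup G).lowerCentralSeries (k + 1)) =
      (l.map fun i => ((Ψ i x * x⁻¹ : G) : G ⧸ (⊤ : Subgroup G).lowerCentralSeries (k + 1)) ^ n i).prod := by
  obtain ⟨h1, h2⟩ := jk_list_prod hk l (fun i => ((Ψ i : MulAut G) ^ n i : MulAut G))
    fun i => (jk_zpow hk (hΨ i) (n i)).1
  exact ⟨h1, fun x => by rw [h2]; exact congrArg List.prod (List.map_congr_left fun i _ =>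
    (jk_zpow hk (hΨ i) (n i)).2 x)⟩

/-- **Johnson value of a product of powers of letters**: `ψ(∏ xᵢ ^ nᵢ)(∏ xᵢ ^ nᵢ)⁻¹ ≡ ∏ (ψ xᵢ xᵢ⁻¹) ^ nᵢ`. [folklore] -/
theorem jk_quot_list_prod_zpow {ι : Type*} {ψ : G ≃* G}
    (hψ : ∀ s, ψ s * s⁻¹ ∈ (⊤ : Subgroup G).lowerCentralSeries k) (l : List ι) (x : ι → G) (n : ι → ℤ) :
    ((ψ (l.map fun i => x i ^ n i).prod * ((l.map fun i => x i ^ n i).prod)⁻¹ : G) :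
        G ⧸ (⊤ : Subgroup G).lowerCentralSeries (k + 1)) =
      (l.map fun i => ((ψ (x i) * (x i)⁻¹ : G) : G ⧸ (⊤ : Subgroup G).lowerCentralSeries (k + 1)) ^ n i).prod := by
  induction l with
  | nil => simp only [List.map_nil, List.prod_nil]; exact jk_quot_one ψ
  | cons i l ih => rw [List.map_cons, List.prod_cons, jk_quot_mul hψ, jk_quot_zpow hψ, ih, List.map_cons, List.prod_cons]

end LayerZeroOne


/-- **Registered helper `helper_johnsonLayerAction`** (sub-goal of stub `stub_layerStepZeroOne`, item
stmt-SmoothPoincare4-14595): an endomorphism of `S_g` congruent to the identity modulo `γₖ₊₁` is congruent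
to the identity modulo `γₖ₊ₘ₊₁` on `γₘ₊₁`. [folklore] -/
theorem helper_johnsonLayerAction : ∀ (g k m : ℕ) (κ : Literature.Topology.FourManifolds.SurfaceGroup g →* Literature.Topology.FourManifolds.SurfaceGroup g), (∀ x, κ x * x⁻¹ ∈ (⊤ : Subgroup (Literature.Topology.FourManifolds.SurfaceGroup g)).lowerCentralSeries k) → ∀ y ∈ (⊤ : Subgroup (Literature.Topology.FourManifolds.SurfaceGroup g)).lowerCentralSeries m, κ y * y⁻¹ ∈ (⊤ : Subgroup (Literature.Topology.FourManifolds.SurfaceGroup g)).lowerCentralSeries (k + m) :=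
  fun _ _ m κ hκ => LayerZeroOne.jk_lcs κ hκ m

end Summit.SmoothPoincare4.SmoothPoincare4.Theorems.ShadowApproximation.NilpotentGenusClass
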